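import Literature.AlgebraicTopology.Homotopy.ZeroCellBasepoints
import HarnessLib

/-!
# Change of base point for induced maps: `f_*` onto / one-to-one at one base point is so along paths

Topic `Literature/AlgebraicTopology/Homotopy`. A. Hatcher, *Algebraic Topology* (2002), §4.1
p. 341–342: the change-of-basepoint isomorphism `β_γ : πₙ(X, γ(1)) → πₙ(X, γ(0))` has inverse
`β_γ̄`, and for a map `f`, `f_* β_γ = β_{fγ} f_*` ("the `β_γ`'s are natural"), so that whether
`f_* : πₙ(Y, y) → πₙ(Z, f y)` is injective / surjective / bijective does not depend on the choice
of `y` in its path component (Hatcher p. 342, the remark used throughout Ch. 4 to reduce to one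
base point). Here, continuing `BasepointChange.lean` (which proves that `β_γ` is onto):

* `BasepointChange.homotopic_surroundLoop_surroundLoop_symm` — `β_γ β_γ̄ q ≃ q`, and
  `homotopic_of_homotopic_surroundLoop` — **`β_γ` is one-to-one on homotopy classes**;
* `BasepointChange.genLoopMap_surroundLoop` — naturality `f ∘ (γ·q) = (f ∘ γ)·(f ∘ q)`;
* `BasepointChange.surjective_homotopyGroupMap_of_joined`, `injective_…`, `bijective_…` —
  **surjectivity / injectivity / bijectivity of `f_*` move along paths in the source**;
* `…_of_zeroCells` — in a Hausdorff CW complex it suffices to check them at the `0`-cells.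

Everything is proved; no named facts.

## References

* A. Hatcher, *Algebraic Topology*, CUP (2002), §4.1 pp. 341–342. [HatcherAT2002]
-/

noncomputable section

open Set Function Topology unitInterval
open scoped Topology.Homotopy unitInterval

namespace Literature.AlgebraicTopology.Homotopy

namespace BasepointChange

variable {N : Type*} [Fintype N] {Y Z : Type*} [TopologicalSpace Y] [TopologicalSpace Z]

/-! ### `β_γ` is one-to-one -/

/-- **`β_γ (β_γ̄ q) ≃ q` rel `∂Iᴺ`** (Hatcher 2002, p. 341: "`β_γ` is an isomorphism with inverse
`β_γ̄`"; the computation inside `exists_surroundLoop_homotopic`, recorded as a statement).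
[cite: HatcherAT2002, §4.1 p. 341] -/
theorem homotopic_surroundLoop_surroundLoop_symm {a b : Z} (γ : Path a b) (q : Ω^ N Z a) :
    GenLoop.Homotopic (surroundLoop γ (surroundLoop γ.symm q)) q := by
  -- the family `F (t, y) = (δ_t · q)(y)` with `δ_t (s) = γ (t (1 - s))`, a path from `γ t` to `a`
  have hΓ : Continuous fun p : I × I => γ (p.1 * σ p.2) :=
    γ.continuous.comp (continuous_induced_rng.2 ((continuous_subtype_val.comp continuous_fst).mul
      (continuous_subtype_val.comp (unitInterval.continuous_symm.comp continuous_snd))))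
  have hcont := continuous_surround (W := I) (Γ := fun t s => γ (t * σ s)) (Q := fun _ => q) hΓ
    (q.1.continuous.comp continuous_snd) (fun t y hy => by
      show q y = γ (t * σ 1)
      rw [GenLoop.boundary q y hy, unitInterval.symm_one, mul_zero, γ.source])
  let F : C(I × (I^N), Z) := ⟨fun p => surround (fun s => γ (p.1 * σ s)) q p.2, hcont⟩
  have hF : ∀ t, ∀ y ∈ Cube.boundary N, F (t, y) = γ t := fun t y hy => by
    show surround (fun s => γ (t * σ s)) q y = γ t
    rw [surround_of_mem_boundary _ _ hy, unitInterval.symm_zero, mul_one]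
  have hbend := homotopicRel_bend F (γ : C(I, Z)) hF
  have h1 : (⟨surround (γ : C(I, Z)) fun y => F (1, y), continuous_surround_curry F _ hF⟩ : C(I^N, Z)) =
      (surroundLoop γ (surroundLoop γ.symm q) : C(I^N, Z)) := by
    ext y
    show surround γ (fun y => surround (fun s => γ (1 * σ s)) q y) y = surround γ (surroundLoop γ.symm q) y
    congr 1
    funext y'
    show surround (fun s => γ (1 * σ s)) q y' = surround γ.symm q y'
    simp only [one_mul]
    rfl
  let F₀ : C(I × (I^N), Z) := ⟨fun p => q p.2, q.1.continuous.comp continuous_snd⟩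
  have hF₀ : ∀ t, ∀ y ∈ Cube.boundary N, F₀ (t, y) = (ContinuousMap.const I a) t := fun t y hy =>
    GenLoop.boundary q y hy
  have hbend₀ := homotopicRel_bend F₀ (ContinuousMap.const I a) hF₀
  have h00 : F₀.curry 0 = (q : C(I^N, Z)) := by ext y; rfl
  have h01 : (⟨surround (ContinuousMap.const I a) fun y => F₀ (1, y), continuous_surround_curry F₀ _ hF₀⟩ :
      C(I^N, Z)) = F.curry 0 := by
    ext y
    show surround (fun _ => a) q y = surround (fun s => γ (0 * σ s)) q y
    congr 1
    funext s
    rw [zero_mul, γ.source]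
  rw [h1] at hbend
  rw [h00, h01] at hbend₀
  exact (hbend₀.trans hbend).symm

/-- **`β_γ̄ (β_γ p) ≃ p`**. [cite: HatcherAT2002, §4.1 p. 341] -/
theorem homotopic_surroundLoop_symm_surroundLoop {a b : Z} (γ : Path a b) (p : Ω^ N Z b) :
    GenLoop.Homotopic (surroundLoop γ.symm (surroundLoop γ p)) p := by
  have h := homotopic_surroundLoop_surroundLoop_symm γ.symm p
  rwa [Path.symm_symm] at h

/-- **`β_γ` is one-to-one on homotopy classes**: `γ·p ≃ γ·p'` rel `∂Iᴺ` implies `p ≃ p'`.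
[cite: HatcherAT2002, §4.1 p. 341] -/
theorem homotopic_of_homotopic_surroundLoop {a b : Z} (γ : Path a b) {p p' : Ω^ N Z b}
    (h : GenLoop.Homotopic (surroundLoop γ p) (surroundLoop γ p')) : GenLoop.Homotopic p p' :=
  ((homotopic_surroundLoop_symm_surroundLoop γ p).symm.trans (surroundLoop_congr γ.symm h)).trans
    (homotopic_surroundLoop_symm_surroundLoop γ p')

/-! ### Naturality and transfer of injectivity / surjectivity of `f_*` along paths -/

/-- **Naturality of `β`**: `f ∘ (γ·q) = (f ∘ γ)·(f ∘ q)` on the nose (Hatcher 2002, p. 342).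
[cite: HatcherAT2002, §4.1 p. 342] -/
theorem genLoopMap_surroundLoop (f : C(Y, Z)) {a b : Y} (γ : Path a b) (q : Ω^ N Y b) :
    genLoopMap f a (surroundLoop γ q) = surroundLoop (γ.map f.continuous) (genLoopMap f b q) := by
  refine GenLoop.ext _ _ fun y => ?_
  show f (surround γ q y) = surround (γ.map f.continuous) (genLoopMap f b q) y
  unfold surround
  split_ifs <;> rfl

/-- **Surjectivity of `f_*` moves along paths**: if `a` is joined to `b` in `Y` and
`f_* : π_N(Y, b) → π_N(Z, f b)` is onto, so is `f_* : π_N(Y, a) → π_N(Z, f a)`.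
[cite: HatcherAT2002, §4.1 p. 342] -/
theorem surjective_homotopyGroupMap_of_joined (f : C(Y, Z)) {a b : Y} (h : Joined a b)
    (hb : Surjective (homotopyGroupMap (N := N) f b)) : Surjective (homotopyGroupMap (N := N) f a) := by
  obtain ⟨γ⟩ := h
  intro β
  induction β using Quotient.inductionOn with
  | h q =>
    obtain ⟨p, hp⟩ := exists_surroundLoop_homotopic (γ.map f.continuous) q
    obtain ⟨α, hα⟩ := hb ⟦p⟧
    induction α using Quotient.inductionOn with
    | h p' =>
      have hp' : GenLoop.Homotopic (genLoopMap f b p') p := Quotient.exact hα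
      refine ⟨⟦surroundLoop γ p'⟧, ?_⟩
      rw [homotopyGroupMap_mk, genLoopMap_surroundLoop]
      exact Quotient.sound ((surroundLoop_congr _ hp').trans hp)

/-- **Injectivity of `f_*` moves along paths**: if `a` is joined to `b` in `Y` and
`f_* : π_N(Y, b) → π_N(Z, f b)` is one-to-one, so is `f_* : π_N(Y, a) → π_N(Z, f a)`.
[cite: HatcherAT2002, §4.1 p. 342] -/
theorem injective_homotopyGroupMap_of_joined (f : C(Y, Z)) {a b : Y} (h : Joined a b)
    (hb : Injective (homotopyGroupMap (N := N) f b)) : Injective (homotopyGroupMap (N := N) f a) := by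
  obtain ⟨γ⟩ := h
  intro α₁ α₂ h12
  induction α₁ using Quotient.inductionOn with
  | h p₁ =>
    induction α₂ using Quotient.inductionOn with
    | h p₂ =>
      have h12' : GenLoop.Homotopic (genLoopMap f a p₁) (genLoopMap f a p₂) := Quotient.exact h12
      obtain ⟨r₁, hr₁⟩ := exists_surroundLoop_homotopic γ p₁
      obtain ⟨r₂, hr₂⟩ := exists_surroundLoop_homotopic γ p₂
      have h1 : GenLoop.Homotopic (surroundLoop (γ.map f.continuous) (genLoopMap f b r₁))
          (surroundLoop (γ.map f.continuous) (genLoopMap f b r₂)) := by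
        rw [← genLoopMap_surroundLoop, ← genLoopMap_surroundLoop]
        exact ((genLoopMap_homotopic f a hr₁).trans h12').trans (genLoopMap_homotopic f a hr₂).symm
      have h2 : GenLoop.Homotopic (genLoopMap f b r₁) (genLoopMap f b r₂) :=
        homotopic_of_homotopic_surroundLoop _ h1
      have h3 : (⟦r₁⟧ : HomotopyGroup N Y b) = ⟦r₂⟧ := hb (Quotient.sound h2)
      exact Quotient.sound (hr₁.symm.trans ((surroundLoop_congr γ (Quotient.exact h3)).trans hr₂))

/-- **Bijectivity of `f_*` moves along paths.** [cite: HatcherAT2002, §4.1 p. 342] -/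
theorem bijective_homotopyGroupMap_of_joined (f : C(Y, Z)) {a b : Y} (h : Joined a b)
    (hb : Bijective (homotopyGroupMap (N := N) f b)) : Bijective (homotopyGroupMap (N := N) f a) :=
  ⟨injective_homotopyGroupMap_of_joined f h hb.1, surjective_homotopyGroupMap_of_joined f h hb.2⟩

/-! ### In a CW complex it suffices to check at the `0`-cells -/

section ZeroCells

variable {W : Type*} [TopologicalSpace W] [T2Space W] [CWComplex (univ : Set W)]

/-- **`f_*` onto at all `0`-cells ⟹ onto at all base points** (Hausdorff CW source).
[cite: HatcherAT2002, §4.1 p. 342] -/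
theorem surjective_homotopyGroupMap_of_zeroCells (f : C(W, Z))
    (h : ∀ y ∈ (RelCWComplex.skeletonLT (univ : Set W) (1 : ℕ) : Set W), Surjective (homotopyGroupMap (N := N) f y))
    (x : W) : Surjective (homotopyGroupMap (N := N) f x) := by
  obtain ⟨y, hy, hxy⟩ := exists_joined_zeroCell x
  exact surjective_homotopyGroupMap_of_joined f hxy (h y hy)

/-- **`f_*` one-to-one at all `0`-cells ⟹ one-to-one at all base points** (Hausdorff CW source).
[cite: HatcherAT2002, §4.1 p. 342] -/
theorem injective_homotopyGroupMap_of_zeroCells (f : C(W, Z))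
    (h : ∀ y ∈ (RelCWComplex.skeletonLT (univ : Set W) (1 : ℕ) : Set W), Injective (homotopyGroupMap (N := N) f y))
    (x : W) : Injective (homotopyGroupMap (N := N) f x) := by
  obtain ⟨y, hy, hxy⟩ := exists_joined_zeroCell x
  exact injective_homotopyGroupMap_of_joined f hxy (h y hy)

/-- **`f_*` bijective at all `0`-cells ⟹ bijective at all base points** (Hausdorff CW source).
[cite: HatcherAT2002, §4.1 p. 342] -/
theorem bijective_homotopyGroupMap_of_zeroCells (f : C(W, Z))
    (h : ∀ y ∈ (RelCWComplex.skeletonLT (univ : Set W) (1 : ℕ) : Set W), Bijective (homotopyGroupMap (N := N) f y))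
    (x : W) : Bijective (homotopyGroupMap (N := N) f x) := by
  obtain ⟨y, hy, hxy⟩ := exists_joined_zeroCell x
  exact bijective_homotopyGroupMap_of_joined f hxy (h y hy)

end ZeroCells

end BasepointChange

end Literature.AlgebraicTopology.Homotopy

end
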